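import Mathlib.Data.Rat.Defs
import Mathlib.Algebra.BigOperators.Group.List.Basic
import Mathlib.Algebra.Order.Field.Basic
import Mathlib.Tactic.Linarith
import Mathlib.Tactic.NormNum
import Mathlib.Tactic.Positivity
import Mathlib.Tactic.FieldSimp
import Mathlib.Tactic.Ring
import HarnessLib

/-!
# Pin cofactors at `(p, ρ) = (5, 1/28)` (T32 arithmetic: `pt28` PART 0)

Uniform value line: INSTRUMENT — kernel-checked WEIGHT ARITHMETIC for the polynomial
weighted-centre model `W(f)` of the cell (engine 1's toy model: census tool `pt28.py` PART 0
"PIN COFACTORS", used by THEOREM-FS-eng1-g35 §11.2 (ii) and §11.3 (`N_W`: "pins of a `W`-slot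
`= w·WV, w·WWW`"); CARVER-NOTES-eng1-g35 T32) — NOT a resolution theorem, NOT a statement about
the Abramovich–Temkin–Włodarczyk invariant, NOT summit progress; AI-written Lean, AI review is
weaker than expert review.

## Dictionary (weights in units of `ρ = 1/28`, i.e. multiplied by `28`)

* slot classes at the point: `F = 5` (the pure `σ⁵`-class weight `5ρ`), `N = 35/6`, `N' = 56/9`,
  `W = 7`, `M = 28/3`, `V = 14` (`= 5/24, 2/9, 1/4, 1/3, 1/2`) — the inductive type `Cls`.
* a PIN of a slot of class `c` is `ε_slot · (cofactor)`, the cofactor of weight `28 − w_c` with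
  all parts of weight `≥ w_c`; a part is a class variable (`Cls`) or a DENSE variable of weight in
  the half-open range `(5, 28/5]` (symbolic, as in `pt28`: "dense parts symbolic in (5, 5.6]").
* a PIN SHAPE is `(us, n)`: the multiset `us` of class parts and the number `n` of dense parts;
  it is FEASIBLE at `c` iff all class parts weigh `≥ w_c`, dense parts occur only if `w_c ≤ 5`,
  and the residual `R = 28 − w_c − Σ us` is `0` when `n = 0`, resp. satisfies `5n < R ≤ (28/5)n`
  when `n ≥ 1` (`dense_sum_bounds` / `exists_dense_parts`: this is exactly "some `n` dense parts
  have total weight `R`").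

## Content (`pt28` PART 0, re-derived here)

* `pinShapes_F`: the TEN pin-cofactor families of an `F`-slot (cofactor weight `23`):
  `N' + 3 dense (Σ = 151/9)`, `W + 3 dense (16)`, `F W + 2 dense (11)`, `N N' + 2 dense (197/18)`,
  `N W + 2 dense (61/6)`, `N' N' + 2 dense (95/9)`, `F N W + 1 dense (31/6)`,
  `F N' N' + 1 dense (50/9)`, `N N N + 1 dense (11/2)`, `N N N' + 1 dense (46/9)`.
* `pinShapes_N`, `_Np`, `_W`, `_M`, `_V`: `N W M`; `N' N' M`; `W V` and `W W W`; `M M`; `V`.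
* `dense_sum_bounds`, `exists_dense_parts`: the feasibility test for the dense parts is exact.

References (context only; elementary arithmetic decided here): [AbramovichTemkinWlodarczyk2024] §5
(weights of a weighted centre); [Wlodarczyk2022] (weighted centres in arbitrary characteristic).
-/

namespace Literature.AlgebraicGeometry.Resolution.WeightedBlowup

namespace Point28Pin

/-- The slot classes at `(5, 1/28)`: `F, N, N', W, M, V`.
[cite: AbramovichTemkinWlodarczyk2024, §5] -/
inductive Cls
  /-- the pure `σ⁵`-class weight `F = 5` -/ | F
  /-- `N = 35/6` (`5/24`) -/ | N
  /-- `N' = 56/9` (`2/9`) -/ | Np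
  /-- `W = 7` (`1/4`) -/ | W
  /-- `M = 28/3` (`1/3`) -/ | M
  /-- `V = 14` (`1/2`) -/ | V
  deriving DecidableEq

/-- Weight of a class (times `28`). [cite: AbramovichTemkinWlodarczyk2024, §5] -/
def Cls.w : Cls → ℚ
  | .F => 5 | .N => 35/6 | .Np => 56/9 | .W => 7 | .M => 28/3 | .V => 14

/-- All six classes, by increasing weight. [cite: AbramovichTemkinWlodarczyk2024, §5] -/
def allCls : List Cls := [.F, .N, .Np, .W, .M, .V]

/-- `allCls` is exhaustive. [cite: AbramovichTemkinWlodarczyk2024, §5] -/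
theorem mem_allCls (c : Cls) : c ∈ allCls := by cases c <;> decide

/-- All multisets of size `d` over a list, each once, as index-nondecreasing lists.
[cite: AbramovichTemkinWlodarczyk2024, §5] -/
def msets : ℕ → List Cls → List (List Cls)
  | 0, _ => [[]]
  | d + 1, ks => ks.tails.flatMap fun tl =>
      match tl with
      | [] => []
      | k :: _ => (msets d tl).map (k :: ·)

/-- Total weight of a list of class parts. [cite: AbramovichTemkinWlodarczyk2024, §5] -/
def wSum (us : List Cls) : ℚ := (us.map Cls.w).sum

/-- The residual weight left for the dense parts of a pin of class `c` with class parts `us`: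
`28 − w_c − Σ us`. [cite: AbramovichTemkinWlodarczyk2024, §5] -/
def residual (c : Cls) (us : List Cls) : ℚ := 28 - c.w - wSum us

/-- Feasibility of a pin shape `(us, n)` at class `c` (see the module docstring).
[cite: AbramovichTemkinWlodarczyk2024, §5] -/
def Feasible (c : Cls) (us : List Cls) (n : ℕ) : Prop :=
  (∀ u ∈ us, c.w ≤ u.w) ∧ (0 < n → c.w ≤ 5) ∧
    ((n = 0 ∧ residual c us = 0) ∨ (0 < n ∧ 5 * (n : ℚ) < residual c us ∧
      residual c us ≤ 28/5 * (n : ℚ)))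

/-- `Feasible` is decidable. [folklore] instance plumbing; context
[cite: AbramovichTemkinWlodarczyk2024, §5]. -/
instance instDecidableFeasible (c : Cls) (us : List Cls) (n : ℕ) : Decidable (Feasible c us n) :=
  inferInstanceAs (Decidable (_ ∧ _ ∧ _))

/-- The candidate shapes: class parts `us` of size `d ≤ 4` and `n ≤ 4 − d` dense parts (a pin
cofactor weighs `≤ 23 < 25`, so it has at most `4` parts of weight `≥ 5`).
[cite: AbramovichTemkinWlodarczyk2024, §5] -/
def shapes : List (List Cls × ℕ) :=
  (List.range 5).flatMap fun d => (msets d allCls).flatMap fun us =>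
    (List.range (5 - d)).map fun n => (us, n)

/-- The feasible pin shapes of class `c`, with their residual dense weight.
[cite: AbramovichTemkinWlodarczyk2024, §5] -/
def pinShapes (c : Cls) : List (List Cls × ℕ × ℚ) :=
  (shapes.filter fun s => decide (Feasible c s.1 s.2)).map fun s => (s.1, s.2, residual c s.1)

/-- **`F`-slot pins** (cofactor weight `23`): the ten families of `pt28` PART 0, as
`(class parts, number of dense parts, their total weight)`.
[cite: AbramovichTemkinWlodarczyk2024, §5] -/
theorem pinShapes_F : pinShapes .F =
    [([.Np], 3, 151/9), ([.W], 3, 16), ([.F, .W], 2, 11), ([.N, .Np], 2, 197/18),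
     ([.N, .W], 2, 61/6), ([.Np, .Np], 2, 95/9), ([.F, .N, .W], 1, 31/6),
     ([.F, .Np, .Np], 1, 50/9), ([.N, .N, .N], 1, 11/2), ([.N, .N, .Np], 1, 46/9)] := by
  decide +kernel

/-- **`N`-slot pins** (cofactor `133/6`): `N W M` only. [cite: AbramovichTemkinWlodarczyk2024, §5] -/
theorem pinShapes_N : pinShapes .N = [([.N, .W, .M], 0, 0)] := by decide +kernel

/-- **`N'`-slot pins** (cofactor `196/9`): `N' N' M` only. [cite: AbramovichTemkinWlodarczyk2024, §5] -/
theorem pinShapes_Np : pinShapes .Np = [([.Np, .Np, .M], 0, 0)] := by decide +kernel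

/-- **`W`-slot pins** (cofactor `21`): `W V` and `W W W` (the pins used by `N_W`).
[cite: AbramovichTemkinWlodarczyk2024, §5] -/
theorem pinShapes_W : pinShapes .W = [([.W, .V], 0, 0), ([.W, .W, .W], 0, 0)] := by decide +kernel

/-- **`M`-slot pins** (cofactor `56/3`): `M M` only. [cite: AbramovichTemkinWlodarczyk2024, §5] -/
theorem pinShapes_M : pinShapes .M = [([.M, .M], 0, 0)] := by decide +kernel

/-- **`V`-slot pins** (cofactor `14`): `V` only. [cite: AbramovichTemkinWlodarczyk2024, §5] -/
theorem pinShapes_V : pinShapes .V = [([.V], 0, 0)] := by decide +kernel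

/-! ## The dense feasibility test is exact -/

/-- `n ≥ 1` dense parts (each in `(5, 28/5]`) have total weight in `(5n, (28/5)n]`.
[cite: AbramovichTemkinWlodarczyk2024, §5] -/
theorem dense_sum_bounds (l : List ℚ) (hl : ∀ x ∈ l, 5 < x ∧ x ≤ 28/5) (hne : l ≠ []) :
    5 * (l.length : ℚ) < l.sum ∧ l.sum ≤ 28/5 * (l.length : ℚ) := by
  induction l with
  | nil => exact absurd rfl hne
  | cons a l ih =>
    obtain ⟨ha1, ha2⟩ := hl a (by simp)
    simp only [List.length_cons, Nat.cast_succ, List.sum_cons]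
    by_cases h : l = []
    · subst h; simp; exact ⟨ha1, ha2⟩
    · obtain ⟨h1, h2⟩ := ih (fun x hx => hl x (by simp [hx])) h
      constructor <;> linarith

/-- Conversely, a residual `R` with `5n < R ≤ (28/5)n`, `n ≥ 1`, IS the total weight of `n`
dense parts (all equal to `R/n`). [cite: AbramovichTemkinWlodarczyk2024, §5] -/
theorem exists_dense_parts (n : ℕ) (hn : 0 < n) (R : ℚ) (h1 : 5 * (n : ℚ) < R)
    (h2 : R ≤ 28/5 * (n : ℚ)) :
    ∃ l : List ℚ, (∀ x ∈ l, 5 < x ∧ x ≤ 28/5) ∧ l.length = n ∧ l.sum = R := by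
  have hn' : (0 : ℚ) < n := by exact_mod_cast hn
  refine ⟨List.replicate n (R / n), fun x hx => ?_, by simp, ?_⟩
  · obtain ⟨-, rfl⟩ := List.eq_of_mem_replicate hx |> fun h => (⟨trivial, h⟩ : True ∧ _)
    constructor
    · rw [lt_div_iff₀ hn']; linarith
    · rw [div_le_iff₀ hn']; linarith
  · rw [List.sum_replicate, nsmul_eq_mul]
    field_simp

/-- Hence `Feasible c us n` says precisely: all class parts weigh `≥ w_c`, dense parts are allowed,
and some `n` dense parts complete the cofactor to weight `28 − w_c`.
[cite: AbramovichTemkinWlodarczyk2024, §5] -/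
theorem feasible_iff (c : Cls) (us : List Cls) (n : ℕ) :
    Feasible c us n ↔ (∀ u ∈ us, c.w ≤ u.w) ∧ (0 < n → c.w ≤ 5) ∧
      ∃ l : List ℚ, (∀ x ∈ l, 5 < x ∧ x ≤ 28/5) ∧ l.length = n ∧ wSum us + l.sum = 28 - c.w := by
  unfold Feasible
  refine and_congr_right fun _ => and_congr_right fun _ => ?_
  constructor
  · rintro (⟨rfl, h0⟩ | ⟨hn, h1, h2⟩)
    · exact ⟨[], by simp, rfl, by unfold residual at h0; simp; linarith⟩
    · obtain ⟨l, hl, hlen, hsum⟩ := exists_dense_parts n hn _ h1 h2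
      exact ⟨l, hl, hlen, by rw [hsum]; unfold residual; ring⟩
  · rintro ⟨l, hl, hlen, hsum⟩
    rcases Nat.eq_zero_or_pos n with rfl | hn
    · left
      have : l = [] := List.eq_nil_of_length_eq_zero hlen
      subst this
      refine ⟨rfl, ?_⟩
      unfold residual; simp at hsum; linarith
    · right
      have hne : l ≠ [] := by rintro rfl; simp at hlen; omega
      obtain ⟨b1, b2⟩ := dense_sum_bounds l hl hne
      rw [hlen] at b1 b2
      refine ⟨hn, ?_, ?_⟩ <;> unfold residual <;> linarith

end Point28Pin

end Literature.AlgebraicGeometry.Resolution.WeightedBlowup
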